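/-
Copyright: the b2b-balaban T⁴-continuum CRUX team, row NE7b leaf lineage `t4-ne7b-formalise-leaf-05` (gen 158). Project licence.
-/
import Mathlib.Analysis.InnerProductSpace.PiL2
import Summits.QuantumFields.BalabanUV.T4Continuum.Spine.NE7b.HilbertSchmidtCurrencyLetters

/-!
# THE (flat) LETTER OF THE (h2) SLOT FOR VECTOR-VALUED BOND FIELDS, IN BOTH CURRENCIES: (i) a flat floor for REAL scalar bond fields under
# scalar-coefficient local terms, `c·Σ_c y_c² ≤ Σ_j(Σ_{c∈inc j} s_{j,c}y_c)²`, lifts VERBATIM to fields with values in any real inner-product space `W`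
# (print's Hilbert–Schmidt `𝔲(n)` ∕ `M_n(ℂ)`): `c·Σ_c‖x c‖² ≤ Σ_j‖Σ_{c∈inc j} s_{j,c}•x c‖²` — Parseval, component by component; (ii) a floor in a LARGER size
# currency transfers to a SMALLER comparable one at the comparison price: `n₁ ≤ n₂`, `n₂² ≤ κn₁²` ⊢ `(c∕κ)·Σ_c n₁(x c)² ≤ Σ_j n₁(T_j x)²` from the `n₂`-floor —
# for `M_n(ℂ)`: the operator-currency flat floor is the Hilbert–Schmidt one divided by `|n|` (row NE7b, node U5c; residual (R2′) family (2), letter (ℓ1); junction lemmas)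

Cell `pub-balaban`, sub-cell `t4`, spine estimate NE7b (`T4WeightBudget.RelWeightBound`; the cell's OWN estimate — NOT PRINTED in [Bałaban 1983–89],
NOT PROVED).  Crux-route work under `Spine/NE7b/`; NOTHING of Bałaban's is asserted; no `def`; zero `sorry`; no `T4Continuum/Support` leaf (FREEZE (0)).
Imports: Mathlib `InnerProductSpace.PiL2` (`OrthonormalBasis.repr`, `EuclideanSpace.real_norm_sq_eq`) and this lineage's `…HilbertSchmidtCurrencyLetters` (HSCL §3:
`opNorm_le_frobenius_norm`, `frobenius_norm_sq_le_card_mul_opNorm_sq` — the two comparison letters of `M_n(ℂ)`; hub olean built).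

WHY.  AFST §3 ∕ AFS2 §3 take per cube the (flat) letter `c·N′_s Y ≤ F⁰_s Y` for the FLAT local form `F⁰ = Σ_j‖T⁰_j Y‖²` on bond fields `Y : C → W` with the size
`N′ = Σ_c‖Y c‖²`.  The tree PROVES the flat floor for REAL scalar fields — B6 Lemma 2.4 via `…AdmissibleFloorIMS.flat_floor_lemma24` (`c = κ₀(d,L)∕(12d²)·L^{−(d+1)}`
in the `⬝ᵥ` currency, flat curl `±1` and flat average `L^{−(d+1)}` coefficients — all REAL SCALARS) — and `…AdmissibleFloorIMS.floor_of_components` lifts a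
`⬝ᵥ`-floor to `m × κ → ℝ`; what the k = 1 instance consumes is the same lift STATED IN AFST's CURRENCY `Σ_c‖x c‖²` for `W`-valued bond fields and scalar-coefficient
terms `T⁰_j x = Σ_{c∈inc j} s_{j,c}•x c` (§2), and — if the row runs the E-side's OPERATOR norm on `M_n(ℂ)` (Q-leaf05-g157-1 UNRULED; leaf-02's CTL∕COSF do) —
the transfer of that Hilbert–Schmidt floor to the operator currency at the price `|n|` (§3–§4; memo `H2-CURRENCY-JUNCTION-g157.md` §2 row «(flat) … ◐ = HS floor ∕ |n|
by HSCL §3»).  After this file the (flat) input of the k = 1 instance is: B6 Lemma 2.4's real floor read on the instance's `inc ∕ s` (AFI §7, by name) + an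
orthonormal real basis of the value space (Mathlib: `stdOrthonormalBasis`), in either currency.

WHAT IS PROVED ([folklore]):
* §1 `repr_sum_smul` (coordinates of `Σ_{c∈S} s_c•x c` are `Σ_{c∈S} s_c·(coordinate of x c)` — `OrthonormalBasis.repr_apply_apply`, `inner_sum`, `real_inner_smul_right`),
  `normSq_eq_sum_repr_sq` (Parseval `‖v‖² = Σ_a (b.repr v a)²`), `sum_normSq_eq_sum_components` (`Σ_c‖x c‖² = Σ_a Σ_c (x c)_a²`),
  `sum_normSq_terms_eq_sum_components` (`Σ_j‖Σ_{c∈inc j} s_{j,c}•x c‖² = Σ_a Σ_j (Σ_{c∈inc j} s_{j,c}(x c)_a)²`).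
* §2 **`flat_floor_of_scalar_floor`** — a real-scalar flat floor `∀ y, good_ℝ y → c·Σ_c y_c² ≤ Σ_j(Σ_{c∈inc j}s_{j,c}y_c)²`, a `W`-predicate `good_W` passing to
  every coordinate field (`good_W x → good_ℝ (c ↦ (x c)_a)`; e.g. «vanishes on the tree bonds» — the axial gauge) ⊢ `∀ x, good_W x → c·Σ_c‖x c‖² ≤ Σ_j‖Σ_{c∈inc j}s_{j,c}•x c‖²`.
* §3 **`floor_transfer_of_two_sizes`** — ABSTRACT: sizes `n₁ ≤ n₂` on the values with `n₂(v)² ≤ κ·n₁(v)²` (`0 < κ`, `0 ≤ c`), terms `T_j`, a floor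
  `c·Σ_c n₂(x c)² ≤ Σ_j n₂(T_j x)²` on `good` ⊢ `(c∕κ)·Σ_c n₁(x c)² ≤ Σ_j n₁(T_j x)²` on `good`.
* §4 **`opNorm_floor_of_frobenius_floor`** — `M_n(ℂ)`-valued bond fields: a Hilbert–Schmidt floor `c·Σ_c‖x c‖²_HS ≤ Σ_j‖T_j x‖²_HS` on `good` gives the operator
  floor `(c∕|n|)·Σ_c‖x c‖²_op ≤ Σ_j‖T_j x‖²_op` on `good` (§3 with HSCL §3's two letters; `‖·‖_op` written `‖Matrix.toEuclideanCLM ·‖` as in HSCL).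
* §5 toy: `W = EuclideanSpace ℝ (Fin 2)`, one bond, one term `s = 1`: the scalar floor `1·y² ≤ (1·y)²` lifts to `1·‖x‖² ≤ ‖1•x‖²` (`example`).

NOT HERE (honest): B6 Lemma 2.4 itself (AFI §7 by name, not restated), the identification of its `q1Of`∕`d1Sq` with scalar-coefficient terms on the instance's
`inc` (leaf-02 ∕ OWNER), the `InnerProductSpace ℝ` structure the row puts on `M_n(ℂ)` ∕ `𝔲(n)` (the tree's `T4AdjointCovarianceUnitary` §Frobenius ∕ `UNGauss`), the
currency ruling (Q-leaf05-g157-1); (A3) ∕ (A1c); NC-NE7b-α UNRULED.  BY-NAME EFFECT ON THE WALL: NONE (the (flat) letter's two junctions; the wall is (R2)).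
NE7b NOT PRINTED ∕ NOT PROVED; spine PROVED 0∕9; rung (B)+1 on ONE finite T⁴ — NOT infinite volume, NOT the mass gap, NOT Clay.
HONEST DEPENDENCY: continuum YM on T⁴ ⇐ BetaPertH ∧ nine spine estimates (0/9 proved); BetaPertH ⇐ (D1) ∧ (D4) ∧ CAP+tail; G-an2-4 gates asym, D1 and NE2/3/4.
-/

set_option autoImplicit false

noncomputable section

open Finset Matrix
open Summit.QuantumFields.BalabanUV.T4Continuum.NE7b.HilbertSchmidtCurrencyLetters
  (opNorm_le_frobenius_norm frobenius_norm_sq_le_card_mul_opNorm_sq)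

namespace Summit.QuantumFields.BalabanUV.T4Continuum.NE7b.AdmissibleFloorFlatComponents

/-! ## §1 Parseval for scalar-coefficient local terms -/

section Parseval

variable {J C κ W : Type*} [Fintype J] [Fintype C] [Fintype κ] [NormedAddCommGroup W] [InnerProductSpace ℝ W]

omit [Fintype J] [Fintype C] in
/-- coordinates of a scalar-coefficient combination: `(b.repr (Σ_{c∈S} s_c•x c)) a = Σ_{c∈S} s_c·(b.repr (x c)) a`. [folklore] -/
theorem repr_sum_smul (b : OrthonormalBasis κ ℝ W) (S : Finset C) (s : C → ℝ) (x : C → W) (a : κ) :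
    b.repr (∑ c ∈ S, s c • x c) a = ∑ c ∈ S, s c * b.repr (x c) a := by
  simp only [OrthonormalBasis.repr_apply_apply, inner_sum, real_inner_smul_right]

omit [Fintype J] [Fintype C] in
/-- PARSEVAL: `‖v‖² = Σ_a (b.repr v a)²`. [folklore] -/
theorem normSq_eq_sum_repr_sq (b : OrthonormalBasis κ ℝ W) (v : W) : ‖v‖ ^ 2 = ∑ a, b.repr v a ^ 2 := by
  rw [← b.repr.norm_map v, EuclideanSpace.real_norm_sq_eq]

omit [Fintype J] in
/-- `Σ_c‖x c‖² = Σ_a Σ_c (b.repr (x c) a)²` (Parseval bondwise, then exchange). [folklore] -/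
theorem sum_normSq_eq_sum_components (b : OrthonormalBasis κ ℝ W) (x : C → W) :
    ∑ c, ‖x c‖ ^ 2 = ∑ a, ∑ c, b.repr (x c) a ^ 2 := by
  rw [Finset.sum_comm]
  exact Finset.sum_congr rfl fun c _ => normSq_eq_sum_repr_sq b (x c)

omit [Fintype C] in
/-- `Σ_j‖Σ_{c∈inc j} s_{j,c}•x c‖² = Σ_a Σ_j (Σ_{c∈inc j} s_{j,c}·(b.repr (x c)) a)²` — the flat form of a `W`-valued field is the sum over coordinates of the
scalar flat forms of its coordinate fields. [folklore] -/
theorem sum_normSq_terms_eq_sum_components (b : OrthonormalBasis κ ℝ W) (inc : J → Finset C) (s : J → C → ℝ) (x : C → W) :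
    ∑ j, ‖∑ c ∈ inc j, s j c • x c‖ ^ 2 = ∑ a, ∑ j, (∑ c ∈ inc j, s j c * b.repr (x c) a) ^ 2 := by
  rw [Finset.sum_comm]
  refine Finset.sum_congr rfl fun j _ => ?_
  rw [normSq_eq_sum_repr_sq b]
  exact Finset.sum_congr rfl fun a _ => by rw [repr_sum_smul]

end Parseval

/-! ## §2 The flat floor for `W`-valued bond fields from the real-scalar one -/

section Components

variable {J C κ W : Type*} [Fintype J] [Fintype C] [Fintype κ] [NormedAddCommGroup W] [InnerProductSpace ℝ W]

/-- **THE (flat) LETTER FOR VECTOR-VALUED FIELDS FROM THE SCALAR ONE.**  A flat floor for real scalar bond fields under scalar-coefficient local terms,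
`∀ y, good_ℝ y → c·Σ_c y_c² ≤ Σ_j (Σ_{c∈inc j} s_{j,c}·y_c)²` (B6 Lemma 2.4's shape: flat curls `s = ±1`, flat averages `s = L^{−(d+1)}`), and a predicate on
`W`-valued fields inherited by every coordinate field (`good_W x → good_ℝ (c ↦ (b.repr (x c)) a)`) ⊢
`∀ x, good_W x → c·Σ_c‖x c‖² ≤ Σ_j‖Σ_{c∈inc j} s_{j,c}•x c‖²` — component by component, then Parseval (§1). [folklore] -/
theorem flat_floor_of_scalar_floor (b : OrthonormalBasis κ ℝ W) (inc : J → Finset C) (s : J → C → ℝ) {c₀ : ℝ}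
    (goodR : (C → ℝ) → Prop) (goodW : (C → W) → Prop)
    (hgood : ∀ x : C → W, goodW x → ∀ a, goodR fun c => b.repr (x c) a)
    (hreal : ∀ y : C → ℝ, goodR y → c₀ * ∑ c, y c ^ 2 ≤ ∑ j, (∑ c ∈ inc j, s j c * y c) ^ 2) :
    ∀ x : C → W, goodW x → c₀ * ∑ c, ‖x c‖ ^ 2 ≤ ∑ j, ‖∑ c ∈ inc j, s j c • x c‖ ^ 2 := by
  intro x hx
  rw [sum_normSq_eq_sum_components b x, sum_normSq_terms_eq_sum_components b inc s x, Finset.mul_sum]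
  exact Finset.sum_le_sum fun a _ => hreal _ (hgood x hx a)

end Components

/-! ## §3 A floor transfers from a larger size currency to a smaller comparable one -/

section Transfer

variable {J C V : Type*} [Fintype J] [Fintype C]

/-- **FLOOR TRANSFER BETWEEN TWO COMPARABLE SIZES** (abstract): `n₁ ≤ n₂` on values, `n₂(v)² ≤ κ·n₁(v)²`, `0 < κ`, `0 ≤ c`; a floor in the `n₂`-currency,
`c·Σ_c n₂(x c)² ≤ Σ_j n₂(T_j x)²` on `good` ⊢ `(c∕κ)·Σ_c n₁(x c)² ≤ Σ_j n₁(T_j x)²` on `good`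
(`Σ_j n₁(T_j x)² ≥ κ⁻¹Σ_j n₂(T_j x)² ≥ (c∕κ)Σ_c n₂(x c)² ≥ (c∕κ)Σ_c n₁(x c)²`). [folklore] -/
theorem floor_transfer_of_two_sizes (n₁ n₂ : V → ℝ) {κ c₀ : ℝ} (hκ : 0 < κ) (hc : 0 ≤ c₀)
    (h12 : ∀ v, n₁ v ≤ n₂ v) (h21 : ∀ v, n₂ v ^ 2 ≤ κ * n₁ v ^ 2) (hn₁ : ∀ v, 0 ≤ n₁ v)
    (T : J → (C → V) → V) (good : (C → V) → Prop)
    (hfloor : ∀ x, good x → c₀ * ∑ c, n₂ (x c) ^ 2 ≤ ∑ j, n₂ (T j x) ^ 2) :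
    ∀ x, good x → c₀ / κ * ∑ c, n₁ (x c) ^ 2 ≤ ∑ j, n₁ (T j x) ^ 2 := by
  intro x hx
  have hA : ∑ c, n₁ (x c) ^ 2 ≤ ∑ c, n₂ (x c) ^ 2 :=
    Finset.sum_le_sum fun c _ => pow_le_pow_left₀ (hn₁ _) (h12 _) 2
  have hB : ∑ j, n₂ (T j x) ^ 2 ≤ κ * ∑ j, n₁ (T j x) ^ 2 := by
    rw [Finset.mul_sum]
    exact Finset.sum_le_sum fun j _ => h21 _
  have hF := hfloor x hx
  rw [div_mul_eq_mul_div, div_le_iff₀ hκ]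
  calc c₀ * ∑ c, n₁ (x c) ^ 2 ≤ c₀ * ∑ c, n₂ (x c) ^ 2 := mul_le_mul_of_nonneg_left hA hc
    _ ≤ ∑ j, n₂ (T j x) ^ 2 := hF
    _ ≤ κ * ∑ j, n₁ (T j x) ^ 2 := hB
    _ = (∑ j, n₁ (T j x) ^ 2) * κ := mul_comm _ _

end Transfer

/-! ## §4 `M_n(ℂ)`: the operator-currency floor is the Hilbert–Schmidt floor divided by `|n|` -/

section MatrixCurrency

open scoped Matrix.Norms.Frobenius

variable {J C n : Type*} [Fintype J] [Fintype C] [Fintype n] [DecidableEq n]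

/-- **THE OPERATOR-CURRENCY (flat) FLOOR FROM THE HILBERT–SCHMIDT ONE, PRICE `|n|`**: for `M_n(ℂ)`-valued bond fields and any terms `T_j`, a floor
`c·Σ_c‖x c‖²_HS ≤ Σ_j‖T_j x‖²_HS` on `good` (`‖·‖` = Frobenius) gives `(c∕|n|)·Σ_c‖x c‖²_op ≤ Σ_j‖T_j x‖²_op` on `good` (`‖·‖_op = ‖Matrix.toEuclideanCLM ·‖`;
§3 with HSCL §3: `‖A‖_op ≤ ‖A‖_HS`, `‖A‖²_HS ≤ |n|·‖A‖²_op`). [folklore] -/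
theorem opNorm_floor_of_frobenius_floor [Nonempty n] (T : J → (C → Matrix n n ℂ) → Matrix n n ℂ) (good : (C → Matrix n n ℂ) → Prop)
    {c₀ : ℝ} (hc : 0 ≤ c₀) (hfloor : ∀ x, good x → c₀ * ∑ c, ‖x c‖ ^ 2 ≤ ∑ j, ‖T j x‖ ^ 2) :
    ∀ x, good x → c₀ / Fintype.card n * ∑ c, ‖Matrix.toEuclideanCLM (n := n) (𝕜 := ℂ) (x c)‖ ^ 2 ≤
      ∑ j, ‖Matrix.toEuclideanCLM (n := n) (𝕜 := ℂ) (T j x)‖ ^ 2 :=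
  floor_transfer_of_two_sizes (fun A => ‖Matrix.toEuclideanCLM (n := n) (𝕜 := ℂ) A‖) (fun A => ‖A‖)
    (by exact_mod_cast Fintype.card_pos) hc opNorm_le_frobenius_norm frobenius_norm_sq_le_card_mul_opNorm_sq
    (fun _ => norm_nonneg _) T good hfloor

end MatrixCurrency

/-! ## §5 Toy: `W = ℝ²`, one bond, one term with coefficient `1` -/

section Toy

/- `J = C = Unit`, `W = EuclideanSpace ℝ (Fin 2)` with its standard basis, `inc _ = {()}`, `s = 1`, `good = True`: the scalar floor `1·Σ y² ≤ Σ_j (Σ_{c} 1·y_c)²`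
(an identity) lifts to `1·Σ‖x c‖² ≤ Σ_j ‖Σ_c 1•x c‖²`. -/
example (x : Unit → EuclideanSpace ℝ (Fin 2)) :
    (1 : ℝ) * ∑ c, ‖x c‖ ^ 2 ≤ ∑ _j : Unit, ‖∑ c ∈ ({()} : Finset Unit), (1 : ℝ) • x c‖ ^ 2 :=
  flat_floor_of_scalar_floor (J := Unit) (EuclideanSpace.basisFun (Fin 2) ℝ) (fun _ => {()}) (fun _ _ => (1 : ℝ)) (c₀ := 1)
    (fun _ => True) (fun _ => True) (fun _ _ _ => trivial)
    (fun y _ => by simp) x trivial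

end Toy

end Summit.QuantumFields.BalabanUV.T4Continuum.NE7b.AdmissibleFloorFlatComponents

end
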